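import Summits.HubbardSuperconductivity.HubbardSuperconductivity.Theorems.DeformationLadderLadderThesisNormalForms
import Summits.HubbardSuperconductivity.HubbardSuperconductivity.Theorems.DeformationLadderAssembly

/-!
# Route `TwistGap`, support `TgThesisToSummit` (item `stmt-HubbardSuperconductivity-1512`)

`TgThesisToSummit : TgThesis → HubbardSuperconductivity`: route TwistGap's strengthened summit
`S⁺` (`TgThesis`, `stmt-HubbardSuperconductivity-1508`: for some `U > 0`, `δ ∈ (0,1/2)`, `λ, c > 0`
and all large even `L`, `c ≤ L⁻⁴ Re⟨φ, Δ_dᴴΔ_d φ⟩ + λ (Re⟨φ, H_L φ⟩ − E₀(L))` on every unit vector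
`φ` of the `(N_L, S^z = 0)` sector) implies the summit.

Proof: by the tree's `ladderThesis_iff_tgThesis`
(`Theorems/DeformationLadderLadderThesisNormalForms.lean`) `S⁺` is the same statement as route
DeformationLadder's thesis `LadderThesis` (some normalised sector ground state of the penalised
model `H_L + (s/L⁴)Δ_dᴴΔ_d` keeps `d`-wave LRO density `≥ a` at every large even `L`), and that
thesis decides the summit by the landed `deformationLadder_assembly_proof`
(`Theorems/DeformationLadderAssembly.lean`: the Kaplan–Horsch–von der Linden two-line comparison of
`H_L` with `H_L + (s/L⁴)Δ_dᴴΔ_d`, then the even-side `liminf` bookkeeping of the summit statement).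
Equivalently and directly: at the witness `(U, δ)` of `S⁺` every normalised sector ground state
`ψ` has `Re⟨ψ, H_L ψ⟩ = E₀(L)`, so `S⁺` evaluated at `ψ` is `c ≤ L⁻⁴ Re⟨ψ, Δ_dᴴΔ_d ψ⟩`.

Sources: D. J. Scalapino, Phys. Rep. 250 (1995) 329, §2; T. A. Kaplan, P. Horsch,
W. von der Linden, J. Phys. Soc. Jpn. 58 (1989) 3894. No definition is introduced.
-/

set_option linter.dupNamespace false

namespace Summit.HubbardSuperconductivity.HubbardSuperconductivity.Theorems.TwistGap

open Summit.HubbardSuperconductivity.HubbardSuperconductivity.Theses.TwistGap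
open Summit.HubbardSuperconductivity.HubbardSuperconductivity.Theorems.DeformationLadder
  (ladderThesis_iff_tgThesis)

/-- **`TgThesisToSummit` holds** (route `TwistGap`, support item
`stmt-HubbardSuperconductivity-1512`): `S⁺ ⇒ HubbardSuperconductivity`. `S⁺` is route
DeformationLadder's `LadderThesis` up to constants (`ladderThesis_iff_tgThesis`), which decides the
summit (`deformationLadder_assembly_proof`). Scalapino, Phys. Rep. 250 (1995) 329, §2.
[cite: Scalapino1995] -/
theorem tgThesisToSummit_proof : TgThesisToSummit := fun h =>
  deformationLadder_assembly_proof (ladderThesis_iff_tgThesis.mpr h)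

end Summit.HubbardSuperconductivity.HubbardSuperconductivity.Theorems.TwistGap
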